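import Summits.AtomisticToContinuum.FouriersLaw.Theorems.ContactStieltjesMeasureStieltjesRepresentationOfPhi4Edge

/-!
# Crux `ContactStieltjesMeasure.StieltjesRepresentation` (stmt-AtomisticToContinuum-15248):
# the narrowed statement, and the equivalence of the crux AS FILED with its `φ⁴` edge

Support file (`--supports stmt-AtomisticToContinuum-15248`), line `cayley-pencil` (continuation lead).
Everything here is a corollary of the landed theorems `stub_stieltjesRepresentation_pos` (the clause on `0 ≤ lam`,
`0 < β`), `stub_harmonicMember` (`lam = β = 0`) and `stieltjesRepresentation_of_phi4Edge`:

* `stub_stieltjesRepresentation_narrowed` (registered sub-goal) — the crux with its range `0 ≤ lam → 0 ≤ β` replaced by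
  `0 ≤ lam → (0 < β ∨ (lam = 0 ∧ β = 0))` (every member the route's assembly `closes` uses, which takes `0 < lam`,
  `0 < β`, plus the harmonic calibration member), SORRY-FREE: the candidate restatement of the item, verbatim;
* `phi4Edge_of_stieltjesRepresentation` / `stieltjesRepresentation_iff_phi4Edge` — the crux AS FILED is EQUIVALENT to
  its `φ⁴`-edge member (`β = 0 < lam`: quartic pinning `ω₂q²/2 + lam q⁴/4`, HARMONIC coupling `r²/2`), i.e. to the
  linear-response/Stieltjes clause for the discrete `φ⁴` chain at every length `N ≥ 2` — a chain outside condition C5 of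
  Cuneo–Eckmann–Hairer–Rey-Bellet 2018 (pinning degree `4 >` coupling degree `2`), for which existence of the steady
  state is open beyond three oscillators and `0` lies in the essential spectrum of the generator for `N ≥ 5`
  (Hairer–Mattingly 2009, §1 and Thm 3.13; barrier `Literature.Barriers.AtomisticToContinuum.StrongPinningBreathers`).
No definitions, no new facts.
-/

noncomputable section

open scoped Topology
open MeasureTheory Filter Set
open Literature.MathematicalPhysics.KineticTheory.HeatConduction

namespace Summit.AtomisticToContinuum.FouriersLaw.Theorems.ContactStieltjesMeasure.CayleyPencil

/-- **The narrowed crux** (candidate restatement of stmt-AtomisticToContinuum-15248, proved): for `ω₂ > 0`, `lam ≥ 0`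
and EITHER `β > 0` OR `lam = β = 0`, and `T > 0`, there is ONE `γ`-free family of bounded monotone `Φ_N` (`N ≥ 2`)
vanishing on `(-∞,0]` such that for every friction `γ > 0`, under weak-NESS uniqueness and along every steady family,
`totalCurrent(μ_{N,T+δ/2,T-δ/2})/δ → (N-1)·γ·∫₀^∞ Φ_N(t)·2t/(γ²+t²)² dt` as `δ → 0`. Case split:
`stub_stieltjesRepresentation_pos` (`0 < β`) and `stub_harmonicMember` (`lam = β = 0`).
[cite: CuneoEckmannHairerReyBellet2018, Thm 2.13] [cite: LaxPhillips1967, Ch. II §3] -/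
theorem stub_stieltjesRepresentation_narrowed :
    ∀ ω₂ lam β : ℝ, 0 < ω₂ → 0 ≤ lam → (0 < β ∨ (lam = 0 ∧ β = 0)) → ∀ T : ℝ, 0 < T → ∃ Φ : ℕ → ℝ → ℝ, ∀ N : ℕ, 2 ≤ N → Monotone (Φ N) ∧ (∀ s : ℝ, s ≤ 0 → Φ N s = 0) ∧ (∃ m : ℝ, ∀ s : ℝ, Φ N s ≤ m) ∧ ∀ γ : ℝ, 0 < γ → (∀ (N' : ℕ) (T_L T_R : ℝ), 0 < T_L → 0 < T_R → ∀ μ ν : MeasureTheory.Measure (Literature.MathematicalPhysics.KineticTheory.HeatConduction.PhaseSpace N'), (Literature.MathematicalPhysics.KineticTheory.HeatConduction.pinnedChain ω₂ lam β γ).IsSteadyState N' T_L T_R μ → (Literature.MathematicalPhysics.KineticTheory.HeatConduction.pinnedChain ω₂ lam β γ).IsSteadyState N' T_L T_R ν → μ = ν) → ∀ μ : (N' : ℕ) → ℝ → ℝ → MeasureTheory.Measure (Literature.MathematicalPhysics.KineticTheory.HeatConduction.PhaseSpace N'), (∀ (N' : ℕ) (T_L T_R : ℝ), 0 < T_L →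 0 < T_R → (Literature.MathematicalPhysics.KineticTheory.HeatConduction.pinnedChain ω₂ lam β γ).IsSteadyState N' T_L T_R (μ N' T_L T_R)) → Filter.Tendsto (fun δ : ℝ => (Literature.MathematicalPhysics.KineticTheory.HeatConduction.pinnedChain ω₂ lam β γ).totalCurrent (μ N (T + δ / 2) (T - δ / 2)) / δ) (nhdsWithin 0 {(0 : ℝ)}ᶜ) (nhds (((N : ℝ) - 1) * γ * ∫ t in Set.Ioi (0 : ℝ), Φ N t * (2 * t / (γ ^ 2 + t ^ 2) ^ 2))) := by
  intro ω₂ lam β hω hl hβ T hT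
  rcases hβ with hβ | ⟨hl0, hβ0⟩
  · exact stub_stieltjesRepresentation_pos ω₂ lam β hω hl hβ T hT
  · subst hl0; subst hβ0
    exact stub_harmonicMember ω₂ hω T hT

/-- **The `φ⁴` edge is a member of the crux as filed**: `StieltjesRepresentation` (range `0 ≤ lam`, `0 ≤ β`)
specialised to `β = 0 < lam` is exactly the registered stub `stub_phi4Edge` of line `cayley-pencil` — the
linear-response/Stieltjes clause for the discrete `φ⁴` chain `pinnedChain ω₂ lam 0 γ`. [cite: HairerMattingly2009, §1] -/
theorem phi4Edge_of_stieltjesRepresentation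
    (h : Summit.AtomisticToContinuum.FouriersLaw.Theses.ContactStieltjesMeasure.StieltjesRepresentation) :
    ∀ ω₂ lam : ℝ, 0 < ω₂ → 0 < lam → ∀ T : ℝ, 0 < T →
      ∃ Φ : ℕ → ℝ → ℝ, ∀ N : ℕ, 2 ≤ N → Monotone (Φ N) ∧ (∀ s : ℝ, s ≤ 0 → Φ N s = 0) ∧
        (∃ m : ℝ, ∀ s : ℝ, Φ N s ≤ m) ∧ ∀ γ : ℝ, 0 < γ →
          (∀ (N' : ℕ) (T_L T_R : ℝ), 0 < T_L → 0 < T_R → ∀ μ ν : Measure (PhaseSpace N'),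
            (pinnedChain ω₂ lam 0 γ).IsSteadyState N' T_L T_R μ →
            (pinnedChain ω₂ lam 0 γ).IsSteadyState N' T_L T_R ν → μ = ν) →
          ∀ μ : (N' : ℕ) → ℝ → ℝ → Measure (PhaseSpace N'),
            (∀ (N' : ℕ) (T_L T_R : ℝ), 0 < T_L → 0 < T_R →
              (pinnedChain ω₂ lam 0 γ).IsSteadyState N' T_L T_R (μ N' T_L T_R)) →
            Tendsto (fun δ : ℝ => (pinnedChain ω₂ lam 0 γ).totalCurrent (μ N (T + δ / 2) (T - δ / 2)) / δ)
              (𝓝[≠] 0)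
              (𝓝 (((N : ℝ) - 1) * γ * ∫ t in Set.Ioi (0 : ℝ), Φ N t * (2 * t / (γ ^ 2 + t ^ 2) ^ 2))) :=
  fun ω₂ lam hω hl T hT => h ω₂ lam 0 hω hl.le le_rfl T hT

/-- **The crux AS FILED is equivalent to its `φ⁴` edge.** Given the landed theorems of line `cayley-pencil` (the clause on
`0 ≤ lam`, `0 < β` and the harmonic member), `StieltjesRepresentation` with range `0 ≤ lam`, `0 ≤ β` holds if and only
if its `β = 0 < lam` member does — the linear-response/Stieltjes clause for the discrete `φ⁴` chain (quartic pinning,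
harmonic coupling) at every length `N ≥ 2`, a chain violating condition C5 of Cuneo–Eckmann–Hairer–Rey-Bellet 2018, whose
steady state is known to exist only up to three oscillators and whose generator has `0` in its essential spectrum for
`N ≥ 5`. This is the formal content of the verdict "misstated (range)": the residual of the item is exactly this edge.
[cite: HairerMattingly2009, §1 and Thm 3.13] [cite: CuneoEckmannHairerReyBellet2018, §1] -/
theorem stieltjesRepresentation_iff_phi4Edge :
    Summit.AtomisticToContinuum.FouriersLaw.Theses.ContactStieltjesMeasure.StieltjesRepresentation ↔
    (∀ ω₂ lam : ℝ, 0 < ω₂ → 0 < lam → ∀ T : ℝ, 0 < T →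
      ∃ Φ : ℕ → ℝ → ℝ, ∀ N : ℕ, 2 ≤ N → Monotone (Φ N) ∧ (∀ s : ℝ, s ≤ 0 → Φ N s = 0) ∧
        (∃ m : ℝ, ∀ s : ℝ, Φ N s ≤ m) ∧ ∀ γ : ℝ, 0 < γ →
          (∀ (N' : ℕ) (T_L T_R : ℝ), 0 < T_L → 0 < T_R → ∀ μ ν : Measure (PhaseSpace N'),
            (pinnedChain ω₂ lam 0 γ).IsSteadyState N' T_L T_R μ →
            (pinnedChain ω₂ lam 0 γ).IsSteadyState N' T_L T_R ν → μ = ν) →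
          ∀ μ : (N' : ℕ) → ℝ → ℝ → Measure (PhaseSpace N'),
            (∀ (N' : ℕ) (T_L T_R : ℝ), 0 < T_L → 0 < T_R →
              (pinnedChain ω₂ lam 0 γ).IsSteadyState N' T_L T_R (μ N' T_L T_R)) →
            Tendsto (fun δ : ℝ => (pinnedChain ω₂ lam 0 γ).totalCurrent (μ N (T + δ / 2) (T - δ / 2)) / δ)
              (𝓝[≠] 0)
              (𝓝 (((N : ℝ) - 1) * γ * ∫ t in Set.Ioi (0 : ℝ), Φ N t * (2 * t / (γ ^ 2 + t ^ 2) ^ 2)))) :=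
  ⟨phi4Edge_of_stieltjesRepresentation, stieltjesRepresentation_of_phi4Edge⟩

end Summit.AtomisticToContinuum.FouriersLaw.Theorems.ContactStieltjesMeasure.CayleyPencil

end
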